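/-
Copyright (c) 2026 the pub-hodgecm-mathlib formalisation cell (harness21).  Prover seat hodgecm-mathlib-K2E1-p15 (g3), Track B ∕ K2-LIT, h413 = `stmt-HodgeConjecture-24833`,
R90-TF section S8 «ContSpec-n½» (planner R90-CS-plan (g0), EMIT S8 WAVE 2 2026-09-04T15:53:11Z «#9 payment = p15's FILE 3», kept by the 15:56:32Z amendment of S8-R7):
the THEOREMS-LEVEL export of socket #9 `isPiN_of_equiv` of `Lines/R90_S8_ResidualSpectrumU3B.lean`, importable by the S5∕S10 payers (which cannot import a `Lines` file).
-/
import Summits.HodgeConjecture.HodgeConjecture.Theorems.R90S8ResidualDefs                  -- ★ D-S8-2′ p861612 (K2-defs1): `IsPiN` (defs-down of B :132–:147, byte-identical)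
import Summits.HodgeConjecture.HodgeConjecture.Theorems.R90S8LocalConstituentsInOfEquiv    -- ★ p861540 (this seat): `localConstituentsIn_of_areUnitarilyEquivalent`
import HarnessLib

/-!
# S8B#9 (payment) — `R90S8IsPiNOfEquiv`: «`π_v = πⁿ(ξ_v)` for all finite `v`» is invariant under unitary equivalence of discrete automorphic representations of `U(Φ₃)`

Track B ∕ K2-LIT, crux h413 = `stmt-HodgeConjecture-24833`, route of record `HCCMUnconditional`; cell `hodgecm-mathlib`, R90-TF programme, section S8 «ContSpec-n½»
(§13.9 residual spectrum).  THE TYPE of `isPiN_of_areUnitarilyEquivalent` is socket #9 `R90.S8.isPiN_of_equiv` of B `Lines/R90_S8_ResidualSpectrumU3B.lean` :262–:267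
VERBATIM, read over D-S8-2′'s `IsPiN` (★ `Theorems/R90S8ResidualDefs.lean`, the defs-down copy B ED.2 imports); B ED.2 pays #9 by `exact isPiN_of_areUnitarilyEquivalent`
or in-file with the same four lines (S8-R7) — this file is the importable export.  THEOREMS ONLY (no `def`, no `instance`, no `notation`, no named-fact hypothesis,
no `sorry`; default heartbeats); lane `--supports stmt-HodgeConjecture-24833 --as helper` (count-neutral).

THE MATHEMATICS ([Rogawski1990, §13.9 (ii) p. 229 «Then `π_v = πⁿ(ξ_v)` for all `v`»; §13.3 p. 201]; [Dixmier1977, §13.1.3]).  ★ `IsPiN P μω hμu ξ` says: there is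
a ξ-local family `Pv` of packets (★ `OneDimAutRepH.IsXiLocalFamily`) which contains every finite local constituent of `P` (★ `LocalConstituentsIn P Pv`) and whose
members at the non-split places are neither supercuspidal nor square-integrable.  Only the middle clause mentions `P`, and it travels along a unitary equivalence
`P ≃ᵤ P′` (★ `localConstituentsIn_of_areUnitarilyEquivalent`, `R90S8LocalConstituentsInOfEquiv` §2: unitarily equivalent closed invariant subspaces of `L²` have
the same smooth local constituents at every finite place).  Hence the same `Pv` witnesses `IsPiN P′ μω hμu ξ`.  The only Lean subtlety is B's instance
ascription `cmDatum L 3 (qsForm L) = adelicGroupData L⁺ L c̄ 3 (qsForm L)` (reducible), repeated here as in ★ `IsPiN`'s body.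
* §1 **`isPiN_of_areUnitarilyEquivalent`** — THE HEAD (#9; the name `isPiN_of_equiv` is held by B's socket in the same namespace `…R90.S8`).
HONEST LABEL: HC_CM is proved only modulo the 7 printed citations (2 remaining named inputs: hLiu418 = `stmt-HodgeConjecture-24832`, h413 = `stmt-HodgeConjecture-24833`) until
rung 0 closes; this file asserts no named fact and closes no summit socket by itself (B's #9 is a support statement); count-neutral.

## References
* [Rogawski1990] J. Rogawski, *Automorphic Representations of Unitary Groups in Three Variables*, Ann. of Math. Stud. 123 (1990), §13.9 p. 229; §13.3 p. 201.
* [Dixmier1977] J. Dixmier, *C\*-algebras* (North-Holland, 1977), §13.1.3.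
-/

set_option autoImplicit false
set_option linter.dupNamespace false  -- the mandated namespace `…HodgeConjecture.HodgeConjecture.R90.S8` (LEAD #1 L1) repeats the summit's segment

noncomputable section

open MeasureTheory NumberField IsDedekindDomain
open Literature.NumberTheory.GaloisRepresentations
open Literature.NumberTheory.Automorphic.Arthur2013.Leaves.TECR
open Literature.NumberTheory.Automorphic Literature.NumberTheory.Automorphic.UnitaryGroup
open Literature.NumberTheory.Rogawski1990
open Summit.HodgeConjecture.HodgeConjecture.Cruxes.H413.K2E1CuspidalSpectrumUnitary
open Summit.HodgeConjecture.HodgeConjecture.Cruxes.H413.R90S8ResidualDefs (IsPiN)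

namespace Summit.HodgeConjecture.HodgeConjecture.R90.S8

/-! ## §1 The head: socket #9 of B, paid -/

/-- **S8B#9 — `IsPiN` is invariant under unitary equivalence** (the type is B's socket `isPiN_of_equiv` verbatim over ★ D-S8-2′ `IsPiN`): for discrete automorphic
representations `P, P′` of `U(Φ₃)(𝔸_{L⁺})` with `P ≃ᵤ P′`, if `π_v = πⁿ(ξ_v)` at every finite `v` for `P` (★ `IsPiN P μω hμu ξ`) then the same holds for `P′`, with the
same ξ-local family: only the clause ★ `LocalConstituentsIn P Pv` mentions `P`, and it travels by ★ `localConstituentsIn_of_areUnitarilyEquivalent`.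
[cite: Rogawski1990, §13.9 p. 229 (ii)] [cite: Dixmier1977, §13.1.3] -/
theorem isPiN_of_areUnitarilyEquivalent :
    ∀ (L : Type) [Field L] [NumberField L] [IsCMField L]
      (μ : Measure (UnitaryGroup.cmDatum L 3 (qsForm L)).automorphicQuotient) [(UnitaryGroup.cmDatum L 3 (qsForm L)).IsAutomorphicMeasure μ]
      (P P' : DiscreteAutomorphicRep (UnitaryGroup.cmDatum L 3 (qsForm L)) μ) (μω : HeckeCharacter L) (hμu : μω.IsUnitary) (ξ : OneDimAutRepH L),
      ContRepresentation.AreUnitarilyEquivalent P.space.toContRep P'.space.toContRep →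
      IsPiN P μω hμu ξ → IsPiN P' μω hμu ξ := by
  intro L _ _ _ μ hμ P P' μω hμu ξ h hP
  haveI : (adelicGroupData (↥(maximalRealSubfield L)) L (IsCMField.complexConj L) 3 (qsForm L)).IsAutomorphicMeasure μ := hμ
  obtain ⟨Pv, hξ, hPv, hn⟩ := hP
  exact ⟨Pv, hξ, localConstituentsIn_of_areUnitarilyEquivalent h hPv, hn⟩

end Summit.HodgeConjecture.HodgeConjecture.R90.S8

end
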